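import Mathlib
import Summits.Ventures.HodgeRepro2.T5ContinuousValuationExtension
import Summits.Ventures.HodgeRepro2.T5RamifiedQuadraticDictionary

/-!
# T5AdicCompletionIntegral — the ring of integers of `w.adicCompletion L` is the integral closure
of the ring of integers of `v.adicCompletion K`, and `e · f = [Lw : Kv]`

Blind cell pub-hodge-repro2, seat p4 (Tier-5 Lean support, annex growth only).
Declaration per README §8(d): uses an L-value-free non-vanishing device: NO.

`T5ContinuousValuationExtension` (p395773) reduced the AKLB instantiation of the (A6)/(A13) kernel
chains on Mathlib's concrete local fields to ONE residual: `Algebra.IsIntegral O_Kv O_Lw`, the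
«completeness input» (the integral closure of the complete DVR `O_Kv` in the finite extension `Lw`
is its valuation ring). This file discharges it for number fields from Mathlib's uniqueness of
extended absolute values over complete fields:

* `spectralNorm_unique_field_norm_ext` — `K` complete, non-trivially normed, ultrametric, `L/K`
  algebraic: every absolute value of `L` extending `‖·‖_K` equals the spectral norm
  `spectralValue (minpoly K y)`;
* `spectralValue_le_one_iff` — a monic polynomial has spectral value `≤ 1` iff all its
  coefficients have norm `≤ 1`.

For `Kv := v.adicCompletion K` (a number field `K`) Mathlib's norm is `q_v ^ log (v x)`. From
`HasExtension` (p395773) the image of a uniformiser has valuation `exp (-e)`, `e ≥ 1`, and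
`w ∘ algebraMap = v ^ e` on `Kv`; the absolute value `b ^ log (w y)` of `Lw` with `b = q_v ^ (1/e)`
then EXTENDS `‖·‖_Kv`, so for `y ∈ O_Lw` the minimal polynomial of `y` over `Kv` has coefficients
in `O_Kv` — `y` is integral over `O_Kv`. Consequences: `IsIntegralClosure O_Lw O_Kv Lw` (instance)
and, through `T5RamifiedQuadraticDictionary` (p394885, row 65), the LOCAL FUNDAMENTAL IDENTITY
`e · f = [Lw : Kv]` for irreducible `ϖ ∈ O_Kv`, `π ∈ O_Lw`.

Hypotheses: `K`, `L` number fields, `[Algebra K L]`, and a continuous algebra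
`[Algebra Kv Lw] [ContinuousSMul Kv Lw] [IsScalarTower K Kv Lw]` — exactly the hypotheses of
Mathlib's own `Module.Finite Kv Lw` instance. Nothing here is asserted about the Tier-5 datum.
-/

namespace Summit.Ventures.HodgeRepro2.T5AdicCompletionIntegral

open IsDedekindDomain HeightOneSpectrum NumberField WithZero WithZeroMulInt Polynomial
open scoped WithZero NNReal

/-! ## §1 Absolute values from `ℤᵐ⁰`-valuations -/

/-- `toNNReal` of a power against the power of the base: `b ^ log (m ^ e) = (b ^ e) ^ log m`. -/
theorem toNNReal_pow_eq {b : ℝ≥0} (hb : b ≠ 0) (e : ℕ) (he : 0 < e) (m : ℤᵐ⁰) :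
    toNNReal hb (m ^ e) = toNNReal (pow_ne_zero e hb) m := by
  by_cases hm : m = 0
  · rw [hm, zero_pow he.ne', map_zero, map_zero]
  · rw [map_pow, toNNReal_neg_apply hb hm, toNNReal_neg_apply (pow_ne_zero e hb) hm,
      ← zpow_natCast, ← zpow_mul, ← zpow_natCast b e, ← zpow_mul, mul_comm]

/-- `toNNReal` depends only on the base, not on the proof of its non-vanishing. -/
theorem toNNReal_congr {b₁ b₂ : ℝ≥0} (h : b₁ = b₂) (h₁ : b₁ ≠ 0) (h₂ : b₂ ≠ 0) (m : ℤᵐ⁰) :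
    toNNReal h₁ m = toNNReal h₂ m := by subst h; rfl

/-- The absolute value `b ^ log (w y)` attached to a `ℤᵐ⁰`-valuation `w` of a field and a base
`b > 1` (Mathlib's `adicAbv` pattern for an arbitrary valuation). -/
noncomputable def absOfValuation {F : Type*} [Field F] (w : Valuation F ℤᵐ⁰) {b : ℝ≥0}
    (hb : 1 < b) : AbsoluteValue F ℝ where
  toFun y := toNNReal (ne_zero_of_lt hb) (w y)
  map_mul' _ _ := by simp
  nonneg' _ := NNReal.zero_le_coe
  eq_zero' _ := by simp
  add_le' x y := by
    have h_mono := (toNNReal_strictMono hb).monotone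
    have h : toNNReal (ne_zero_of_lt hb) (w (x + y)) ≤
        max (toNNReal (ne_zero_of_lt hb) (w x)) (toNNReal (ne_zero_of_lt hb) (w y)) := by
      rw [← h_mono.map_max]; exact h_mono (w.map_add x y)
    calc ((toNNReal (ne_zero_of_lt hb) (w (x + y)) : ℝ≥0) : ℝ)
        ≤ max (toNNReal (ne_zero_of_lt hb) (w x) : ℝ) (toNNReal (ne_zero_of_lt hb) (w y) : ℝ) := by
          exact_mod_cast h
      _ ≤ _ := max_le_add_of_nonneg (NNReal.coe_nonneg _) (NNReal.coe_nonneg _)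

/-- `absOfValuation w hb y = b ^ log (w y)`. -/
theorem absOfValuation_apply {F : Type*} [Field F] (w : Valuation F ℤᵐ⁰) {b : ℝ≥0} (hb : 1 < b)
    (y : F) : absOfValuation w hb y = toNNReal (ne_zero_of_lt hb) (w y) := rfl

/-- `absOfValuation w hb y ≤ 1 ↔ w y ≤ 1`. -/
theorem absOfValuation_le_one_iff {F : Type*} [Field F] (w : Valuation F ℤᵐ⁰) {b : ℝ≥0}
    (hb : 1 < b) (y : F) : absOfValuation w hb y ≤ 1 ↔ w y ≤ 1 := by
  rw [absOfValuation_apply, ← toNNReal_le_one_iff hb]; exact_mod_cast Iff.rfl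

/-! ## §2 Mathlib's norm on `v.adicCompletion K` for a number field `K` -/

section Kv

variable {K : Type*} [Field K] [NumberField K] (v : HeightOneSpectrum (𝓞 K))

/-- `‖x‖ ≤ 1 ↔ v x ≤ 1` on `v.adicCompletion K`. -/
theorem norm_le_one_iff (x : v.adicCompletion K) : ‖x‖ ≤ 1 ↔ Valued.v x ≤ 1 := by
  rw [FinitePlace.norm_def,
    ← toNNReal_le_one_iff (NumberField.HeightOneSpectrum.one_lt_absNorm_nnreal v)]
  exact_mod_cast Iff.rfl

/-- `‖x‖ < 1 ↔ v x < 1` on `v.adicCompletion K`. -/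
theorem norm_lt_one_iff (x : v.adicCompletion K) : ‖x‖ < 1 ↔ Valued.v x < 1 := by
  rw [FinitePlace.norm_def,
    ← toNNReal_lt_one_iff (NumberField.HeightOneSpectrum.one_lt_absNorm_nnreal v)]
  exact_mod_cast Iff.rfl

/-- A uniformiser has norm `≠ 1`: Mathlib's norm on `v.adicCompletion K` is non-trivial. -/
theorem exists_ne_zero_norm_ne_one : ∃ x : v.adicCompletion K, x ≠ 0 ∧ ‖x‖ ≠ 1 := by
  obtain ⟨ϖ, hϖ⟩ := valuedAdicCompletion_surjective K v (exp (-1))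
  have h1 : Valued.v ϖ < 1 := by rw [hϖ, ← exp_zero, exp_lt_exp]; norm_num
  refine ⟨ϖ, ?_, ((norm_lt_one_iff v ϖ).mpr h1).ne⟩
  rintro rfl
  rw [map_zero] at hϖ
  exact exp_ne_zero hϖ.symm

/-- `v.adicCompletion K` as a non-trivially normed field — Mathlib's `NormedField` instance with
the non-triviality witness; no new norm is introduced. -/
noncomputable instance instNontriviallyNormedField : NontriviallyNormedField (v.adicCompletion K) :=
  NontriviallyNormedField.ofNormNeOne (exists_ne_zero_norm_ne_one v)

/-- `v.adicCompletion K` has characteristic zero (it contains `K`). -/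
instance instCharZero : CharZero (v.adicCompletion K) :=
  charZero_of_injective_algebraMap (algebraMap K (v.adicCompletion K)).injective

/-- The ring of integers of `Kv` is the closed unit ball of Mathlib's norm. -/
theorem mem_adicCompletionIntegers_iff_norm_le_one (x : v.adicCompletion K) :
    x ∈ v.adicCompletionIntegers K ↔ ‖x‖ ≤ 1 := by
  rw [mem_adicCompletionIntegers, norm_le_one_iff]

end Kv

/-! ## §3 The extension `Lw / Kv`: the power identity, the extended absolute value, integrality,
and `e · f = [Lw : Kv]` -/

section Ext

variable {K : Type*} [Field K] [NumberField K] (v : HeightOneSpectrum (𝓞 K))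
variable {L : Type*} [Field L] [NumberField L] [Algebra K L] (w : HeightOneSpectrum (𝓞 L))
variable [Algebra (v.adicCompletion K) (w.adicCompletion L)]
  [ContinuousSMul (v.adicCompletion K) (w.adicCompletion L)]
  [IsScalarTower K (v.adicCompletion K) (w.adicCompletion L)]

omit [Algebra K L] [IsScalarTower K (v.adicCompletion K) (w.adicCompletion L)] in
/-- The image of a uniformiser of `Kv` has valuation `exp (-e)` for a positive integer `e`
(p395773's `HasExtension`: the image has valuation `< 1`). -/
theorem exists_val_algebraMap_eq_exp_neg {ϖ : v.adicCompletion K} (hϖ : Valued.v ϖ = exp (-1)) :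
    ∃ e : ℕ, 0 < e ∧
      Valued.v (algebraMap (v.adicCompletion K) (w.adicCompletion L) ϖ) = exp (-(e : ℤ)) := by
  have h1 : Valued.v (algebraMap (v.adicCompletion K) (w.adicCompletion L) ϖ) < 1 := by
    rw [Valuation.HasExtension.val_map_lt_one_iff (Valued.v : Valuation (v.adicCompletion K) ℤᵐ⁰),
      hϖ, ← exp_zero, exp_lt_exp]; norm_num
  have h0 : Valued.v (algebraMap (v.adicCompletion K) (w.adicCompletion L) ϖ) ≠ 0 := by
    rw [Ne, Valuation.zero_iff, map_eq_zero]
    rintro rfl; rw [map_zero] at hϖ; exact exp_ne_zero hϖ.symm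
  obtain ⟨m, hm⟩ : ∃ m : ℤ,
      Valued.v (algebraMap (v.adicCompletion K) (w.adicCompletion L) ϖ) = exp m :=
    ⟨_, (exp_log h0).symm⟩
  have hm0 : m < 0 := by rw [hm, ← exp_zero, exp_lt_exp] at h1; exact h1
  refine ⟨(-m).toNat, by omega, ?_⟩
  rw [hm, Int.toNat_of_nonneg (by omega), neg_neg]

omit [Algebra K L] [IsScalarTower K (v.adicCompletion K) (w.adicCompletion L)] in
/-- `w (algebraMap x) = (v x) ^ e` for every `x ∈ Kv`, given a uniformiser `ϖ` with
`w (algebraMap ϖ) = exp (-e)`: write `x = u * ϖ ^ (-n)` with `v u = 1`, `n = log (v x)`, and use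
`w (algebraMap u) = 1` (p395773). -/
theorem val_algebraMap_eq_pow {ϖ : v.adicCompletion K} (hϖ : Valued.v ϖ = exp (-1)) {e : ℕ}
    (he0 : 0 < e)
    (he : Valued.v (algebraMap (v.adicCompletion K) (w.adicCompletion L) ϖ) = exp (-(e : ℤ)))
    (x : v.adicCompletion K) :
    Valued.v (algebraMap (v.adicCompletion K) (w.adicCompletion L) x) = Valued.v x ^ e := by
  by_cases hx : x = 0
  · subst hx
    rw [map_zero, map_zero, map_zero, zero_pow he0.ne']
  · have hϖ0 : ϖ ≠ 0 := by rintro rfl; rw [map_zero] at hϖ; exact exp_ne_zero hϖ.symm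
    have hvx : Valued.v x ≠ 0 := (Valuation.ne_zero_iff _).mpr hx
    set n : ℤ := log (Valued.v x) with hn
    have hu : Valued.v (x * ϖ ^ n) = 1 := by
      rw [map_mul, map_zpow₀, hϖ, ← exp_zsmul, ← exp_log hvx, ← hn, ← exp_add]
      simp
    have hu' : Valued.v (algebraMap (v.adicCompletion K) (w.adicCompletion L) (x * ϖ ^ n)) = 1 := by
      rw [Valuation.HasExtension.val_map_eq_one_iff
        (Valued.v : Valuation (v.adicCompletion K) ℤᵐ⁰)]
      exact hu
    have hx' : x = x * ϖ ^ n * ϖ ^ (-n) := by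
      rw [mul_assoc, ← zpow_add₀ hϖ0, add_neg_cancel, zpow_zero, mul_one]
    conv_lhs => rw [hx']
    rw [map_mul, map_mul, hu', one_mul, map_zpow₀, map_zpow₀, he, ← exp_zsmul, ← exp_log hvx,
      ← hn, ← exp_nsmul]
    congr 1
    simp only [smul_eq_mul, nsmul_eq_mul]
    ring

omit [Algebra K L] [Algebra (v.adicCompletion K) (w.adicCompletion L)]
  [ContinuousSMul (v.adicCompletion K) (w.adicCompletion L)]
  [IsScalarTower K (v.adicCompletion K) (w.adicCompletion L)] in
/-- The base `b = q_v ^ (1/e) > 1` with `b ^ e = q_v` (`q_v` = the absolute norm of `v`). -/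
theorem exists_base (e : ℕ) (he : 0 < e) :
    ∃ b : ℝ≥0, 1 < b ∧ b ^ e = (Ideal.absNorm v.asIdeal : ℝ≥0) := by
  refine ⟨(Ideal.absNorm v.asIdeal : ℝ≥0) ^ ((1 : ℝ) / e), ?_, ?_⟩
  · exact NNReal.one_lt_rpow (NumberField.HeightOneSpectrum.one_lt_absNorm_nnreal v)
      (by positivity)
  · rw [← NNReal.rpow_natCast, ← NNReal.rpow_mul, one_div_mul_cancel (by exact_mod_cast he.ne'),
      NNReal.rpow_one]

omit [Algebra K L] [ContinuousSMul (v.adicCompletion K) (w.adicCompletion L)]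
  [IsScalarTower K (v.adicCompletion K) (w.adicCompletion L)] in
/-- With `w ∘ algebraMap = v ^ e` and `b ^ e = q_v`, the absolute value `b ^ log (w ·)` of `Lw`
EXTENDS Mathlib's norm `q_v ^ log (v ·)` of `Kv`. -/
theorem absOfValuation_algebraMap (e : ℕ) (he : 0 < e)
    (hxe : ∀ x : v.adicCompletion K,
      Valued.v (algebraMap (v.adicCompletion K) (w.adicCompletion L) x) = Valued.v x ^ e)
    {b : ℝ≥0} (hb : 1 < b) (hbe : b ^ e = (Ideal.absNorm v.asIdeal : ℝ≥0))
    (x : v.adicCompletion K) :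
    absOfValuation (Valued.v : Valuation (w.adicCompletion L) ℤᵐ⁰) hb
      (algebraMap (v.adicCompletion K) (w.adicCompletion L) x) = ‖x‖ := by
  rw [absOfValuation_apply, hxe, toNNReal_pow_eq _ e he,
    toNNReal_congr hbe _ (NumberField.HeightOneSpectrum.absNorm_ne_zero v), FinitePlace.norm_def]

/-- THE COMPLETENESS INPUT, given the power identity: an element `y` of `Lw` with `w y ≤ 1` is
integral over `O_Kv`. The absolute value `b ^ log (w ·)` extends `‖·‖_Kv`, hence equals the
spectral norm (`spectralNorm_unique_field_norm_ext`, `Kv` complete); `spectralValue (minpoly Kv y)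
≤ 1` forces every coefficient of the minimal polynomial into `O_Kv` (`spectralValue_le_one_iff`),
and the polynomial descended to `O_Kv` (`Polynomial.toSubring`) is monic with root `y`. -/
theorem isIntegral_of_val_le_one_of_pow (e : ℕ) (he : 0 < e)
    (hxe : ∀ x : v.adicCompletion K,
      Valued.v (algebraMap (v.adicCompletion K) (w.adicCompletion L) x) = Valued.v x ^ e)
    (y : w.adicCompletion L) (hy : Valued.v y ≤ 1) :
    IsIntegral (v.adicCompletionIntegers K) y := by
  obtain ⟨b, hb, hbe⟩ := exists_base v e he
  set f : AbsoluteValue (w.adicCompletion L) ℝ :=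
    absOfValuation (Valued.v : Valuation (w.adicCompletion L) ℤᵐ⁰) hb with hf
  have hf_ext : ∀ x : v.adicCompletion K,
      f (algebraMap (v.adicCompletion K) (w.adicCompletion L) x) = ‖x‖ :=
    fun x => absOfValuation_algebraMap v w e he hxe hb hbe x
  have hspec := spectralNorm_unique_field_norm_ext hf_ext y
  have hfy : f y ≤ 1 := (absOfValuation_le_one_iff _ hb y).mpr hy
  have hint : IsIntegral (v.adicCompletion K) y := Algebra.IsIntegral.isIntegral y
  have hmonic : (minpoly (v.adicCompletion K) y).Monic := minpoly.monic hint
  have hcoeff : ∀ n, ‖(minpoly (v.adicCompletion K) y).coeff n‖ ≤ 1 :=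
    (spectralValue_le_one_iff hmonic).mp (by
      change spectralNorm (v.adicCompletion K) (w.adicCompletion L) y ≤ 1
      rw [← hspec]; exact hfy)
  have hcoeffs : ↑(minpoly (v.adicCompletion K) y).coeffs ⊆
      ((v.adicCompletionIntegers K).toSubring : Set (v.adicCompletion K)) := by
    intro c hc
    obtain ⟨n, -, rfl⟩ := Polynomial.mem_coeffs_iff.mp hc
    exact (mem_adicCompletionIntegers_iff_norm_le_one v _).mpr (hcoeff n)
  refine ⟨(minpoly (v.adicCompletion K) y).toSubring _ hcoeffs,
    (Polynomial.monic_toSubring _ _ _).mpr hmonic, ?_⟩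
  rw [← Polynomial.aeval_def, ← Polynomial.aeval_map_algebraMap (v.adicCompletion K)]
  have hmap : Polynomial.map (algebraMap (v.adicCompletionIntegers K) (v.adicCompletion K))
      ((minpoly (v.adicCompletion K) y).toSubring _ hcoeffs) = minpoly (v.adicCompletion K) y :=
    Polynomial.map_toSubring _ _ _
  rw [hmap]
  exact minpoly.aeval _ y

omit [Algebra K L] [IsScalarTower K (v.adicCompletion K) (w.adicCompletion L)] in
/-- The power identity `w ∘ algebraMap = v ^ e` holds for some `e ≥ 1` (p395773). -/
theorem exists_val_algebraMap_eq_pow :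
    ∃ e : ℕ, 0 < e ∧ ∀ x : v.adicCompletion K,
      Valued.v (algebraMap (v.adicCompletion K) (w.adicCompletion L) x) = Valued.v x ^ e := by
  obtain ⟨ϖ, hϖ⟩ := valuedAdicCompletion_surjective K v (exp (-1))
  obtain ⟨e, he0, he⟩ := exists_val_algebraMap_eq_exp_neg v w hϖ
  exact ⟨e, he0, val_algebraMap_eq_pow v w hϖ he0 he⟩

/-- An element of `Lw` of valuation `≤ 1` is integral over `O_Kv`. -/
theorem isIntegral_of_val_le_one (y : w.adicCompletion L) (hy : Valued.v y ≤ 1) :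
    IsIntegral (v.adicCompletionIntegers K) y :=
  let ⟨e, he, hxe⟩ := exists_val_algebraMap_eq_pow v w
  isIntegral_of_val_le_one_of_pow v w e he hxe y hy

/-- `O_Lw` is integral over `O_Kv` — the residual named by p395773, discharged. -/
instance isIntegral_adicCompletionIntegers :
    Algebra.IsIntegral (v.adicCompletionIntegers K) (w.adicCompletionIntegers L) :=
  ⟨fun y => (isIntegral_algebraMap_iff
    (FaithfulSMul.algebraMap_injective (w.adicCompletionIntegers L) (w.adicCompletion L))).mp
    (isIntegral_of_val_le_one v w (y : w.adicCompletion L) y.2)⟩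

/-- `O_Lw` is the integral closure of `O_Kv` in `Lw` (p395773's `isIntegralClosure_of_isIntegral`
with the residual discharged). -/
instance isIntegralClosure_adicCompletionIntegers :
    IsIntegralClosure (w.adicCompletionIntegers L) (v.adicCompletionIntegers K)
      (w.adicCompletion L) :=
  T5ContinuousValuationExtension.isIntegralClosure_of_isIntegral

/-- THE LOCAL FUNDAMENTAL IDENTITY on Mathlib's number-field completions: for irreducible
`ϖ ∈ O_Kv` and `π ∈ O_Lw`, `e · f = [Lw : Kv]` with `e` = `ramificationIdx'` and `f` =
`inertiaDeg'` (row 65, p394885, on the concrete DVR pair). -/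
theorem ramificationIdx'_mul_inertiaDeg'_eq_finrank (ϖ : v.adicCompletionIntegers K)
    (hϖ : Irreducible ϖ) (π : w.adicCompletionIntegers L) (hπ : Irreducible π) :
    (Ideal.span {ϖ}).ramificationIdx' (Ideal.span {π}) *
        (Ideal.span {ϖ}).inertiaDeg' (Ideal.span {π}) =
      Module.finrank (v.adicCompletion K) (w.adicCompletion L) :=
  T5RamifiedQuadraticDictionary.ramificationIdx'_mul_inertiaDeg'_eq_finrank
    (v.adicCompletionIntegers K) (v.adicCompletion K) (w.adicCompletion L)
    (w.adicCompletionIntegers L) ϖ hϖ π hπ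

end Ext

end Summit.Ventures.HodgeRepro2.T5AdicCompletionIntegral
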